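import Literature.MathematicalPhysics.QuantumFieldTheory.Balaban1983to89.Beta.ResolventComposition

/-!
# `BalabanUV.Beta.FP.TwoLevelDefectFormula` — road «FP» for binder row D1, sub-row **MS-1-GAUGE (explicit potentials, finite level, part 1)** (owner d1-p3 gen 12,
# `LEAVES-FP.md` l.549; design `HOME/b2b-balaban-beta-d1-p3/JETS-JM-DESIGN.md` v2 §4 (c)): THE EXPLICIT TWO-LEVEL DEFECT OF THE TYPED COVARIANCE FIELDS FOR AN
# ARBITRARY (NOT NECESSARILY CO-CLOSED) FINITELY SUPPORTED FORCE — an5's `GcolSum_decomposition` WITH THE GAUGE TERM KEPT: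
# `U_{N′} = U_M + ⟨δdδ Γ_M(·; κ₀, x₀), μ_U⟩ + Σ (𝒬_M U_{N′})·ℋ_M`; the middle term pairs the level-`M` covariance column's GAUGE QUANTITY (block-constant, (G)) with
# the level-`N′` GAUGE MULTIPLIER `μ_U` of `U` (zero `N′`-block means by (M), NOT zero `M`-block means) and equals `Σ'_y (δdδΓ_M)(M•y)·blockSum_M(μ_U)(y)` —
# every `d`, every `N′ = M·L`; UNCONDITIONAL

HONEST DEPENDENCY (page 1, mandatory): continuum YM on T⁴ ⇐ BetaPertH ∧ nine spine estimates (0/9 proved); BetaPertH ⇐ (D1) ∧ (D4) ∧ CAP+tail;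
G-an2-4 gates asym, D1 and NE2/3/4.  HONEST FRAMING (cell contract, verbatim): «discharging `BetaPertH` makes Bałaban's UV stability UNCONDITIONAL —
a real constructive-QFT result; it is NOT the continuum limit and NOT the Clay problem.»  THIS MODULE is an5's Green-pairing argument
(`ResolventComposition.GcolSum_decomposition`, §7) re-run VERBATIM with ONE step changed: the Euler–Lagrange identity of the combination is used in its general
form `curvAdj_curv_GcolSum` (gauge term `dz (codiff₁ (dz μ_U))` present) instead of `curvAdj_curv_GcolSum_of_coclosed`; the kept term is moved onto `μ_U` by
three adjunctions (`lip1_dz`, `lip0_codiff₁`, `lip1_dz`).  Every lemma BY NAME from `KKTFluctuationEnergy` ∕ `ResolventComposition` (an5 lineage).  No `def`,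
no `def … : Prop`, nothing cited, 0 sorry; 0 estimates of Bałaban's constrained objects; 0∕4 row-D1 binders; NOT the kernel form of the defect in the force
leg, NOT the perfect level, NOT (STEP)∕SDF, NOT D1, NOT BetaPertH, NOT continuum, NOT Clay.  «not in print; our bookkeeping».
ABSOLUTE RULE (cell charter, verbatim): «No internally-minted statement may enter as a cited fact. Every hypothesis is either kernel-proved in this package or a
verbatim quotation of a PUBLISHED theorem with page reference. The manuscript(s) under audit are NOT citable for their own disputed steps — they are the thing
under adjudication; programme-internal (2001/route/tribunal) claims are never citable.»

WHY.  an5 located the gauge-slice defect of the two-level law (`K1aNeg`: false entrywise; `K1aTrans`: true on co-closed test forms) and `FP/TwoLevelGaugeDefect` ∕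
`FP/PerfectGaugeDefect(Bottom)` (this gen) showed what survives entrywise is pure gauge in the free leg against co-closed data.  Road FP's (STEP) door meets the
defect INSIDE the one-loop traces, against vertex legs that are NOT co-closed; N2b needs the defect ITSELF.  THIS FILE gives it at finite level, in closed form:
the typed KKT rows (`KKTFluctuationUnique.SolvesKKT`: (EL) `d*dA = 𝒬ᵀφ + dz(codiff₁(dz μ)) + F`, (G) `δdδA ∈ BC_N`, (M) zero block means of `μ`, (Q)) make the defect
the pairing of two GAUGE data — Γ_M's block-constant gauge quantity against the `M`-block sums of `U`'s level-`N′` gauge multiplier.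

CONTENT.  **`GcolSum_decomposition_general`** (`N′ = M·L`, any finite combination `U_{N′} = Σ_{b∈S} a_b Γ_{N′,b}`):
`U_{N′}(κ₀,x₀) = U_M(κ₀,x₀) + lip0 (codiff₁ (dz (codiff₁ (Gcol_M κ₀ x₀)))) (McolSum_{N′} S a) + Σ'_{w′} Σ_{l″} contourSum M U_{N′} l″ w′ · wH_M κ₀ l″ (x₀ − M•w′)`;
**`gaugeTerm_eq_tsum_blockSum`**: the middle term `= Σ'_y (δdδ Γ_M(·;κ₀,x₀))(M•y) · blockSum M (McolSum_{N′} S a) y` ((G) of `Γ_M`, `Gam_G`, + `tsum_blocks`).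
NEXT (row MS-1-GAUGE residual): the force-leg kernel form of `y ↦ blockSum_M(GamM_{N′}(·; l, y))` and of `(κ₀,x₀) ↦ (δdδΓ_M)(M•y)` (= `Γ_M` on the exact force
`dz(δ dz δ_{M•y})` by `Gam_symm`), then `dec (Lc^j)`, units, `j → ∞`.
Provenance: road «FP» OWNER, unit b2b-balaban-beta-d1-p3 gen 12 (prover-b2b-balaban-beta-d1-p3-g12-0), 2026-08-21; no existing file touched.
-/

namespace Summit.QuantumFields.BalabanUV.Beta.FP.TwoLevelDefectFormula

noncomputable section

open Literature.MathematicalPhysics.QuantumFieldTheory.Balaban1983to89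
open Literature.MathematicalPhysics.QuantumFieldTheory.Balaban1983to89.Beta
open AffineAveraging (Form0 Form1 Form2 unitVec dz curv curvAdj codiff₁ box toSite blockSum contourSum)
open AffineReproduction (contourSumAdj IsBlockConst)
open KernelSpecInstance (wH)
open KKTFluctuationKernel (Gam GamΦ GamM Gam_G GamM_M Gam_Q)
open KKTFluctuationEnergy (lip0 lip1 lip2 lip2_comm summable_mul_of_bdd summable_mul_of_bdd' lip1_curvAdj lip1_contourSumAdj lip1_dz lip0_codiff₁
  lip1_add summable_curv summable_dz summable_codiff₁ abs_dz_le abs_codiff₁_le abs_contourSumAdj_le tsum_mul_eq_zero_of_blockConst Gcol Mcol Φcol δcol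
  GcolSum Gcol_bdd_summable Mcol_bdd_summable Φcol_bdd curvAdj_curv_Gcol Gam_symm)
open ResolventComposition (δSum McolSum ΦcolSum GcolSum_bdd_summable curvAdj_curv_GcolSum lip1_Gcol_δSum abs_δSum_le isBlockConst_GcolSum
  GamΦ_eq_neg_wH contourSum_mul isBlockConst_of_mul)

variable {d : ℕ}

/-- [our proof] **THE TWO-LEVEL DECOMPOSITION OF A COVARIANCE FIELD FOR A GENERAL FINITELY SUPPORTED FORCE** (every `d`, `N′ = M·L`).  For a finite
combination `U_{N′} = Σ_{b∈S} a_b Γ_{N′, b}` (force `Σ a_b δ_b`, NOT assumed co-closed):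
`U_{N′}(κ₀, x₀) = U_M(κ₀, x₀) + Σ'_x (δdδ Γ_M(·; κ₀, x₀))(x) · μ_U(x) + Σ'_{w′} Σ_{l″} (𝒬_M U_{N′})(l″, w′) · ℋ_M(κ₀, l″; x₀ − M•w′)`,
where `μ_U = McolSum_{N′} S a` is the level-`N′` GAUGE MULTIPLIER of `U` and `δdδ Γ_M(·; κ₀, x₀) = codiff₁ (dz (codiff₁ (Gcol_M κ₀ x₀)))` is the (block-constant,
(G)) gauge quantity of the level-`M` covariance column.  an5's Green pairing (`GcolSum_decomposition`) VERBATIM with the gauge term of `U`'s Euler–Lagrange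
identity (`curvAdj_curv_GcolSum`) KEPT instead of killed by `McolSum_eq_zero`; the OTHER cross gauge term `⟨U, dδd GamM_M⟩` still dies ((G) of `U` at level
`N′` ⟹ at level `M` by `isBlockConst_of_mul`, against (M) of `Γ_M`).  For a co-closed force `μ_U = 0` and this is `GcolSum_decomposition`. -/
theorem GcolSum_decomposition_general {N' M L : ℕ} [NeZero N'] [NeZero M] [NeZero L] (hN : N' = M * L)
    (S : Finset (Fin (d + 1) × AffineAveraging.Site (d + 1))) (a : Fin (d + 1) × AffineAveraging.Site (d + 1) → ℝ)
    (κ₀ : Fin (d + 1)) (x₀ : AffineAveraging.Site (d + 1)) :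
    GcolSum (N := N') S a κ₀ x₀
      = GcolSum (N := M) S a κ₀ x₀
        + lip0 (codiff₁ (dz (codiff₁ (Gcol (N := M) κ₀ x₀)))) (McolSum (N := N') S a)
        + ∑' w' : (Fin (d + 1) → ℤ), ∑ l'' : Fin (d + 1),
            contourSum M (GcolSum (N := N') S a) l'' w' * wH (N := M) (d := d) κ₀ l'' (x₀ - (M : ℤ) • w') := by
  subst hN
  obtain ⟨K, hUb, hUs, hΦUb, hMUb, hMUs⟩ := GcolSum_bdd_summable (N := M * L) S a
  have hELU := curvAdj_curv_GcolSum (N := M * L) S a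
  have hGU := isBlockConst_GcolSum (N := M * L) S a
  set U : Form1 (d + 1) ℝ := GcolSum (N := M * L) S a with hUdef
  set μU : Form0 (d + 1) ℝ := McolSum (N := M * L) S a with hμUdef
  obtain ⟨C, _, hbdd, hsum⟩ := Gcol_bdd_summable (N := M) (d := d)
  obtain ⟨CM, _, hMb, hMs⟩ := Mcol_bdd_summable (N := M) (d := d)
  obtain ⟨CΦ, _, hΦ⟩ := Φcol_bdd (N := M) (d := d)
  have hM : 0 < M := Nat.pos_of_ne_zero (NeZero.ne M)
  -- bounds on the gauge term of `U`'s Euler–Lagrange identity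
  have g1 : ∀ κ x, |dz μU κ x| ≤ 2 * K := fun κ x => abs_dz_le hMUb κ x
  have g2 : ∀ x, |codiff₁ (dz μU) x| ≤ (d + 1 : ℕ) * (2 * (2 * K)) := fun x => abs_codiff₁_le g1 x
  have g3 : ∀ κ x, |dz (codiff₁ (dz μU)) κ x| ≤ 2 * ((d + 1 : ℕ) * (2 * (2 * K))) := fun κ x => abs_dz_le g2 κ x
  -- the pairing computed from `U`'s Euler–Lagrange identity (gauge term kept):
  -- `⟨U, d*d Γ_M⟩ = ⟨Γ_M, 𝒬_{ML}ᵀ Φ^U + d(δ d μ_U) + Σ a δ⟩ = 0 + ⟨δdδ Γ_M, μ_U⟩ + U_M(κ₀, x₀)`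
  have sQ : ∀ μ', Summable (fun x => Gcol (N := M) κ₀ x₀ μ' x * contourSumAdj (M * L) (ΦcolSum (N := M * L) S a) μ' x) :=
    fun μ' => summable_mul_of_bdd' (hsum κ₀ x₀ μ') (fun x => abs_contourSumAdj_le hΦUb μ' x)
  have sG : ∀ μ', Summable (fun x => Gcol (N := M) κ₀ x₀ μ' x * dz (codiff₁ (dz μU)) μ' x) :=
    fun μ' => summable_mul_of_bdd' (hsum κ₀ x₀ μ') (g3 μ')
  have sδ : ∀ μ', Summable (fun x => Gcol (N := M) κ₀ x₀ μ' x * δSum S a μ' x) :=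
    fun μ' => summable_mul_of_bdd' (hsum κ₀ x₀ μ') (abs_δSum_le S a μ')
  have sQG : ∀ μ', Summable (fun x => Gcol (N := M) κ₀ x₀ μ' x
      * (contourSumAdj (M * L) (ΦcolSum (N := M * L) S a) + dz (codiff₁ (dz μU))) μ' x) := fun μ' => by
    have h := (sQ μ').add (sG μ')
    simpa only [Pi.add_apply, mul_add] using h
  -- the kept gauge term: `⟨Γ_M(·; κ₀, x₀), d(δ d μ_U)⟩ = ⟨δdδ Γ_M(·; κ₀, x₀), μ_U⟩` (three adjunctions)
  have hT : lip1 (Gcol (N := M) κ₀ x₀) (dz (codiff₁ (dz μU)))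
      = lip0 (codiff₁ (dz (codiff₁ (Gcol (N := M) κ₀ x₀)))) μU := by
    have hdzμ : ∀ κ, Summable (dz μU κ) := fun κ => summable_dz hMUs κ
    have e1 : ∀ x, |codiff₁ (Gcol (N := M) κ₀ x₀) x| ≤ (d + 1 : ℕ) * (2 * C) := fun x => abs_codiff₁_le (hbdd κ₀ x₀) x
    have e2 : ∀ κ x, |dz (codiff₁ (Gcol (N := M) κ₀ x₀)) κ x| ≤ 2 * ((d + 1 : ℕ) * (2 * C)) := fun κ x => abs_dz_le e1 κ x
    rw [lip1_dz (hbdd κ₀ x₀) (summable_codiff₁ hdzμ), lip0_codiff₁ e1 hdzμ, lip1_dz e2 hMUs]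
  have hP0 : lip1 U (curvAdj (curv (Gcol (N := M) κ₀ x₀)))
      = lip0 (codiff₁ (dz (codiff₁ (Gcol (N := M) κ₀ x₀)))) μU + GcolSum (N := M) S a κ₀ x₀ := by
    rw [lip1_curvAdj hUb (fun κ l => summable_curv (hsum κ₀ x₀) κ l), lip2_comm,
      ← lip1_curvAdj (hbdd κ₀ x₀) (fun κ l => summable_curv hUs κ l), hELU, lip1_add sQG sδ, lip1_add sQ sG,
      lip1_contourSumAdj (N := M * L) (hsum κ₀ x₀) hΦUb, hT, lip1_Gcol_δSum]
    have hz : ∑' y, ∑ κ, ΦcolSum (N := M * L) S a κ y * contourSum (M * L) (Gcol (N := M) κ₀ x₀) κ y = 0 := by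
      refine (tsum_congr fun y => ?_).trans tsum_zero
      refine Finset.sum_eq_zero fun κ _ => ?_
      have h0 : contourSum M (Gcol (N := M) κ₀ x₀) = 0 := by
        funext κ' y'
        exact Gam_Q (N := M) κ₀ x₀ κ' y'
      have hQ : contourSum (M * L) (Gcol (N := M) κ₀ x₀) κ y = 0 := by
        rw [contourSum_mul M L hM, h0]
        simp [contourSum]
      rw [hQ, mul_zero]
    rw [hz, zero_add]
  -- the pairing computed from `Γ_M`'s Euler–Lagrange identity (an5's `GcolSum_decomposition`, verbatim)
  have h1 : lip1 U (contourSumAdj M (Φcol (N := M) κ₀ x₀))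
      = -∑' w' : (Fin (d + 1) → ℤ), ∑ l'' : Fin (d + 1),
          contourSum M U l'' w' * wH (N := M) (d := d) κ₀ l'' (x₀ - (M : ℤ) • w') := by
    rw [lip1_contourSumAdj (N := M) hUs (hΦ κ₀ x₀), ← tsum_neg]
    refine tsum_congr fun w' => ?_
    rw [← Finset.sum_neg_distrib]
    refine Finset.sum_congr rfl fun l'' _ => ?_
    rw [show Φcol (N := M) κ₀ x₀ l'' w' = GamΦ (N := M) l'' w' κ₀ x₀ from rfl, GamΦ_eq_neg_wH]
    ring
  have h2 : lip1 U (dz (codiff₁ (dz (Mcol (N := M) κ₀ x₀)))) = 0 := by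
    have e1 : ∀ x, |codiff₁ U x| ≤ (d + 1 : ℕ) * (2 * K) := fun x => abs_codiff₁_le hUb x
    have e2 : ∀ κ x, |dz (codiff₁ U) κ x| ≤ 2 * ((d + 1 : ℕ) * (2 * K)) := fun κ x => abs_dz_le e1 κ x
    have e3 : ∀ x, |codiff₁ (dz (codiff₁ U)) x| ≤ (d + 1 : ℕ) * (2 * (2 * ((d + 1 : ℕ) * (2 * K)))) :=
      fun x => abs_codiff₁_le e2 x
    have hdzM : ∀ κ, Summable (dz (Mcol (N := M) κ₀ x₀) κ) := fun κ => summable_dz (hMs κ₀ x₀) κ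
    rw [lip1_dz hUb (summable_codiff₁ hdzM), lip0_codiff₁ e1 hdzM, lip1_dz e2 (hMs κ₀ x₀)]
    exact tsum_mul_eq_zero_of_blockConst (N := M) e3 (isBlockConst_of_mul hGU) (hMs κ₀ x₀) (GamM_M (N := M) κ₀ x₀)
  have h3 : lip1 U (δcol κ₀ x₀) = U κ₀ x₀ := by
    unfold KKTFluctuationEnergy.lip1
    have e : ∀ x, ∑ μ' : Fin (d + 1), U μ' x * δcol κ₀ x₀ μ' x = if x = x₀ then U κ₀ x₀ else 0 := by
      intro x
      by_cases hx : x = x₀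
      · subst hx
        simp [δcol]
      · simp [δcol, hx]
    rw [tsum_congr e, tsum_eq_single x₀ (fun x hx => if_neg hx), if_pos rfl]
  have sT1 : ∀ μ', Summable (fun x => U μ' x * contourSumAdj M (Φcol (N := M) κ₀ x₀) μ' x) :=
    fun μ' => summable_mul_of_bdd' (hUs μ') (fun x => abs_contourSumAdj_le (hΦ κ₀ x₀) μ' x)
  have hT2b : ∀ μ' x, |dz (codiff₁ (dz (Mcol (N := M) κ₀ x₀))) μ' x| ≤ 2 * ((d + 1 : ℕ) * (2 * (2 * CM))) := fun μ' x =>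
    abs_dz_le (fun z => abs_codiff₁_le (fun κ w => abs_dz_le (hMb κ₀ x₀) κ w) z) μ' x
  have sT2 : ∀ μ', Summable (fun x => U μ' x * dz (codiff₁ (dz (Mcol (N := M) κ₀ x₀))) μ' x) :=
    fun μ' => summable_mul_of_bdd' (hUs μ') (hT2b μ')
  have sδ' : ∀ μ', Summable (fun x => U μ' x * δcol κ₀ x₀ μ' x) := fun μ' =>
    summable_mul_of_bdd' (M := 1) (hUs μ') (fun x => by
      unfold δcol
      split_ifs <;> simp)
  have s12 : ∀ μ', Summable (fun x => U μ' x
      * (contourSumAdj M (Φcol (N := M) κ₀ x₀) + dz (codiff₁ (dz (Mcol (N := M) κ₀ x₀)))) μ' x) := fun μ' => by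
    have h := (sT1 μ').add (sT2 μ')
    simpa only [Pi.add_apply, mul_add] using h
  have hP : lip1 U (curvAdj (curv (Gcol (N := M) κ₀ x₀)))
      = -(∑' w' : (Fin (d + 1) → ℤ), ∑ l'' : Fin (d + 1),
          contourSum M U l'' w' * wH (N := M) (d := d) κ₀ l'' (x₀ - (M : ℤ) • w')) + 0 + U κ₀ x₀ := by
    rw [curvAdj_curv_Gcol, lip1_add s12 sδ', lip1_add sT1 sT2, h1, h2, h3]
  rw [hP0] at hP
  linarith

/-- [our proof] **THE DEFECT READS THE `M`-BLOCK SUMS OF THE GAUGE MULTIPLIER**: since `δdδ Γ_M(·; κ₀, x₀)` is `M`-block-constant ((G) of the level-`M`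
covariance column, `Gam_G`), the gauge term is `Σ'_y (δdδ Γ_M(·; κ₀, x₀))(M•y) · blockSum_M(μ_U)(y)` — it VANISHES iff the `M`-block sums of the level-`N′`
gauge multiplier of `U` do (they vanish over `N′`-blocks by (M); for a co-closed force `μ_U = 0`, an5's `McolSum_eq_zero`). -/
theorem gaugeTerm_eq_tsum_blockSum {N' M : ℕ} [NeZero N'] [NeZero M]
    (S : Finset (Fin (d + 1) × AffineAveraging.Site (d + 1))) (a : Fin (d + 1) × AffineAveraging.Site (d + 1) → ℝ)
    (κ₀ : Fin (d + 1)) (x₀ : AffineAveraging.Site (d + 1)) :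
    lip0 (codiff₁ (dz (codiff₁ (Gcol (N := M) κ₀ x₀)))) (McolSum (N := N') S a)
      = ∑' y : (Fin (d + 1) → ℤ), codiff₁ (dz (codiff₁ (Gcol (N := M) κ₀ x₀))) ((M : ℤ) • y)
          * blockSum M (McolSum (N := N') S a) y := by
  obtain ⟨K, _, _, _, hMUb, hMUs⟩ := GcolSum_bdd_summable (N := N') S a
  obtain ⟨C, _, hbdd, hsum⟩ := Gcol_bdd_summable (N := M) (d := d)
  have e1 : ∀ x, |codiff₁ (Gcol (N := M) κ₀ x₀) x| ≤ (d + 1 : ℕ) * (2 * C) := fun x => abs_codiff₁_le (hbdd κ₀ x₀) x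
  have e2 : ∀ κ x, |dz (codiff₁ (Gcol (N := M) κ₀ x₀)) κ x| ≤ 2 * ((d + 1 : ℕ) * (2 * C)) := fun κ x => abs_dz_le e1 κ x
  have e3 : ∀ x, |codiff₁ (dz (codiff₁ (Gcol (N := M) κ₀ x₀))) x| ≤ (d + 1 : ℕ) * (2 * (2 * ((d + 1 : ℕ) * (2 * C)))) :=
    fun x => abs_codiff₁_le e2 x
  have hG : IsBlockConst M (codiff₁ (dz (codiff₁ (Gcol (N := M) κ₀ x₀)))) := Gam_G (N := M) κ₀ x₀
  unfold KKTFluctuationEnergy.lip0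
  rw [KKTFluctuationEnergy.tsum_blocks (N := M) (summable_mul_of_bdd e3 hMUs)]
  refine tsum_congr fun y => ?_
  unfold AffineAveraging.blockSum
  rw [Finset.mul_sum]
  refine Finset.sum_congr rfl fun b hb => ?_
  rw [hG y b hb]

end

end Summit.QuantumFields.BalabanUV.Beta.FP.TwoLevelDefectFormula
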